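import Mathlib.Analysis.Calculus.IteratedDeriv.Lemmas
import Mathlib.Analysis.Calculus.Deriv.ZPow
import Mathlib.Analysis.SpecialFunctions.Pow.Real
import Literature.MathematicalPhysics.StatisticalMechanics.Theil2006
import Literature.MathematicalPhysics.StatisticalMechanics.MiePotential
import HarnessLib

/-!
# Barrier: the Lennard-Jones potential lies outside the hypothesis classes of the proved "localized pair potential" crystallization theorems (Theil 2006, Flatley–Theil 2015)

Topic: `Literature/Barriers/AtomisticToContinuum` (barrier catalogue of
`AtomisticToContinuum/Crystallization`, D-0021; seed "only 2D results (Theil)").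

## The obstruction, as printed

* Blanc–Lewin 2015, §2.3 (arXiv p. 7): "In a famous article [Theil-06], Theil dealt with smoother,
  more realistic potentials (which look like `V_LJ`), in dimension two. However, he still used
  restrictive hypotheses on `V`. This work has been extended to dimension three recently in
  [FlaThe-13], in which an additional three-body term is added, which favors particular angles
  between bonds."
* Bétermin 2023, §1 (arXiv p. 3): "crystallization results for long-range pairwise potentials have
  only been proven in [Crystal] [= Theil 2006] (on a triangular lattice) and recently in
  [BDLPSquare] (on a square lattice) where the potentials are strongly repulsive at the origin and
  have very narrow wells (for the triangular lattice, in order to catch only the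
  nearest-neighbors) or sufficiently large well one (for the square lattice, in order to also
  catch the next-nearest neighbors) before converging rapidly to zero."
* De Luca–Friesecke 2017, §1 (arXiv p. 3), on the Lennard-Jones `(p, 2p)` energy: "As regards
  mathematical results, even in dimension `d = 2` crystallization of minimizers has not been
  proved rigorously"; "the Heitmann-Radin potential is the large-`p` limit of the Lennard-Jones
  potential … physically, one is taking a 'brittle limit' in which the width of the well of the
  pair potential is compressed to zero"; (p. 4) "One might expect that when `V` is 'close' to
  (HR), minimizing configurations are 'close' to subsets of a suitable lattice … The deep insight
  of Theil [Theil] (see [ELi] for an extension and [FlatleyTheil, FTTT] for a computer-aided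
  generalization to a class of three-body potentials in 3D) that `N`-particle lattice subsets
  achieve the optimal asymptotic energy per particle … is very suggestive of such a behaviour".
* Theil 2006, §1, Theorem 1.1: the hypotheses on `V` carry one small parameter `α ∈ (0, α₀)`,
  `α₀ < 1/3`: (2) `V ≥ 1/α` on `[0, 1-α]`, (3) `V'' ≥ 1` on `(1-α, 1+α)`, (4) `V ≥ -α` on
  `[1+α, 4/3]`, (5) `|V''(r)| ≤ α r⁻⁷` on `(4/3, ∞)`, plus the normalization (1) of the
  triangular lattice sum (tree: `Theil2006.IsAdmissible α V`, soft-core reading). All three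
  theorems (1.1 energy, 1.2 periodic b.c., 1.3 Dirichlet b.c.) are statements in `ℝ²` about the
  triangular lattice `A₂`.
* Flatley–Theil 2015, §1 (arXiv p. 3): "Our results are concerned with localized potentials where
  the strength of the interaction between pairs of particles decays with an inverse power law";
  (p. 4) "The role of the three-body potential `V₃` is of solely a technical nature. It is quite
  likely that the assumptions of Theorem 1.1 can be relaxed so that also pure pair models are
  covered"; §2 (p. 7): "The pair potentials are chosen to have growth behavior similar to that of a
  Lennard-Jones potential, whilst the three-body potentials take a generalized form of the
  Stillinger-Weber potential", Definition 2.1 (`α`-localized potentials `(V, Ψ) ∈ Y_α`,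
  transcribed below as `FlatleyTheil2015.IsLocalizedPair` / `IsLocalizedTriple`); §2.1:
  "Assumptions [`|V''| ≤ α^{1/4}` on `[1+α, √(7/2)]`] and [`|V''(r)| ≤ α r⁻¹⁰` on `[√(7/2), ∞)`],
  which characterize the decay of `V`, entail that medium and long-range interactions are much
  weaker than the short-range interactions"; "It is conceivable that the dependence of Theorem 1.1
  on `V₃` can be omitted entirely. Although this remains an open problem, the following conjecture
  [Conjecture 2.2] provides a possible route to eliminate the necessity of `V₃`."

None of these sources prints a proof that the Lennard-Jones potential violates the hypotheses; the
theorem of this file supplies it for the two hypothesis classes that exist in Lean.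

## Contents (all proved; no named facts)

* `lennardJonesWith A B r = A r⁻¹² - B r⁻⁶`, the `(12, 6)` family (`lennardJones =
  lennardJonesWith (1/12) (1/6)`; every `μ · lennardJones (ℓ ·)` is a member,
  `smul_lennardJones_comp_mul`), and `iter_deriv_two_lennardJonesWith`:
  `V''(r) = 156 A r⁻¹⁴ - 42 B r⁻⁸` for `r ≠ 0`.
* `Theil2006.not_isAdmissible_lennardJonesWith`: for ALL real `α, A, B`,
  `¬ Theil2006.IsAdmissible α (lennardJonesWith A B)`. For `A > 0, B ≥ 0, α > 0` (the
  Lennard-Jones case) only (3) and (5) are used: (3) at `r = 1 + 9α/10` gives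
  `156 A ≥ (1 + 9α/10)¹⁴`, (5) at `r = 27/20` and `r = 2` gives `156 A ≤ 22.4 α`, and
  `(1 + 9α/10)¹⁴ ≥ 1 + 12.6 α + 73.71 α² > 22.4 α`. (Remaining sign patterns: `α ≤ 0` forces
  `V'' = 0` beyond `4/3`, hence `A = B = 0`, contradicting (1); `B < 0 ≤ A` makes `V ≥ 0`,
  contradicting `∑ V(|ξ|) = -6`; `A, B < 0` is excluded by (3), (5) again.)
* `FlatleyTheil2015.fccPoint`, `fccLatticeSum`, `IsLocalizedPair α V` (item 1 of Definition 2.1: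
  the pair potential of `(V, Ψ) ∈ Y_α`), `IsLocalizedTriple α Ψ` (item 2), and
  `FlatleyTheil2015.not_isLocalizedPair_lennardJonesWith`: for ALL `α, A, B`,
  `¬ IsLocalizedPair α (lennardJonesWith A B)` — for `B ≠ 0` the decay condition
  `|V''(r)| ≤ α r⁻¹⁰` on `[√(7/2), ∞)` fails because `r⁸ V''(r) → -42 B ≠ 0`; for `B = 0` the
  normalization `V(1) = -1` forces `A = -1` and then `V''(1) = -156 < 1`;
  `FlatleyTheil2015.not_isLocalizedTriple_zero`: `Ψ = 0` is not admissible (`Ψ(1,1,1) = -1` is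
  required), i.e. Theorem 1.1 of Flatley–Theil has no pure pair-potential instance.
* `LocalizedPotentialsExcludeLennardJones` (the barrier, conjunction of the three) and
  `LocalizedPotentialsExcludeLennardJones_holds`; corollaries `.theil`, `.flatleyTheil` for
  `μ · lennardJones (ℓ ·)`.
* (audit 2026-08-15) `mieWith A B p q r = A r⁻ᵖ - B r^{-q}` (`lennardJonesWith = mieWith · · 12 6`),
  `iter_deriv_two_mieWith`; the structural decay statements
  `FlatleyTheil2015.not_isLocalizedPair_of_tendsto_pow_mul_deriv2` (`rᵏ V'' → c ≠ 0`, `k < 10`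
  ⇒ not localized), `FlatleyTheil2015.not_isLocalizedPair_mieWith` (all `α, A, B`, `0 < q < 8`,
  `q < p`), `Theil2006.not_isAdmissible_of_tendsto_pow_mul_deriv2` (`k < 7`).

## Wording risks / design choices

* `lennardJonesWith A B 0 = 0` by `0⁻¹ = 0`; no proof below evaluates `V` or `V''` at `r ≤ 1`
  except `V''(1)`, `V(1)`, so the junk value plays no role (in particular we do NOT use that
  Lennard-Jones fails to be `C¹` at `0`, although Flatley–Theil's `Y_α ⊂ C¹([0,∞)) × …` would
  already exclude a hard singularity at the origin).
* `Theil2006.IsAdmissible` is the tree's soft-core, real-valued reading of Theil's hypotheses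
  (`Theil2006.lean`, module docstring); Theil also allows `V = +∞` on `[0, ρ₀]`, which does not
  concern (3) and (5).
* Flatley–Theil's Definition 2.1 is vendored here only as far as needed to state the barrier with
  an explicit technique class: item 1 (pair potential) and item 2 (three-body potential) in full,
  with the fcc lattice `L_fcc = (b₁ b₂ b₃)ℤ³`, `b₁ = (0,1,1)/√2`, `b₂ = (1,0,1)/√2`,
  `b₃ = (1,1,0)/√2` of their §1. As in `Theil2006.IsNormalized`, summability of the lattice sums
  `∑_{k ∈ L_fcc∖0} V(r|k|)` (`r > 0`) is required explicitly (implied in the paper by the decay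
  assumptions), so that "`min_{r>0} ∑_{k} (V(r|k|) - V(|k|)) = 0`" reads
  `∑ V(|k|) ≤ ∑ V(r|k|)` for all `r > 0` without junk values. `V''`, `V'` are `deriv^[2] V`,
  `deriv V` (the paper writes `V''` for `V ∈ C¹([0,∞))` without comment). The energy `E(Y)`,
  `E_fcc(r)` and Theorem 1.1 itself are not restated (a `litbuild` of `FlatleyTheil2015` should
  move these definitions to `StatisticalMechanics/`).

## References (read at the cited places)

* F. Theil, Comm. Math. Phys. 262 (2006) 209–236, §1 Theorem 1.1 (via the tree transcription
  `Theil2006.lean`; the paper is not held, acquisition request acq-00256).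
* L. Flatley, F. Theil, Arch. Ration. Mech. Anal. 218 (2015) 363–416 (arXiv:1407.0692), §1
  (pp. 3–4), §2 Definition 2.1, §2.1 (p. 7).
* X. Blanc, M. Lewin, EMS Surv. Math. Sci. 2 (2015) 255–306 (arXiv:1504.01153), §2.3 (p. 7),
  §2.5 (p. 10).
* L. Bétermin, J. Phys. A 56 (2023) 145204 (arXiv:2104.09795), §1 (p. 3), Theorem 1.1 (p. 4).
* L. De Luca, G. Friesecke, J. Nonlinear Sci. 28 (2018) (arXiv:1605.00034), §1 (pp. 3–4).
* L. Bétermin, L. De Luca, M. Petrache, Arch. Ration. Mech. Anal. 240 (2021) 987–1053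
  (arXiv:1907.06105), §1.2 Theorem 1.3, §1.4 (restatement of Theil's hypotheses (i)–(v)), §1.5 (6').
* M. Ayala, R. Choksi, B. Wirth, arXiv:2506.22614 (2025), §4 Theorem 4.1.
-/

noncomputable section

open scoped BigOperators Topology
open Filter Set

namespace Literature.Barriers.AtomisticToContinuum

/-! ## The `(12, 6)` family and its second derivative -/

/-- The `(12, 6)` inverse-power ("Lennard-Jones type", Mie) pair potential with coefficients
`A, B`: `V(r) = A r⁻¹² - B r⁻⁶`. The tree's `lennardJones` is `A = 1/12`, `B = 1/6`
(`lennardJones_eq_lennardJonesWith`); positive multiples of dilations stay in the family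
(`smul_lennardJones_comp_mul`). [cite: Betermin2023, §1 (arXiv p. 3)] -/
def lennardJonesWith (A B : ℝ) (r : ℝ) : ℝ :=
  A * r⁻¹ ^ 12 - B * r⁻¹ ^ 6

/-- Unfolding lemma. [folklore] -/
@[simp] theorem lennardJonesWith_apply (A B r : ℝ) :
    lennardJonesWith A B r = A * r⁻¹ ^ 12 - B * r⁻¹ ^ 6 := rfl

/-- `V_LJ = lennardJonesWith (1/12) (1/6)`. [cite: BlancLewin2015, §1.1 (3)] -/
theorem lennardJones_eq_lennardJonesWith : Literature.MathematicalPhysics.StatisticalMechanics.lennardJones = lennardJonesWith (1 / 12) (1 / 6) := by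
  funext r; simp [Literature.MathematicalPhysics.StatisticalMechanics.lennardJones, lennardJonesWith]

/-- Every multiple of a dilation of the Lennard-Jones potential, `r ↦ μ V_LJ(ℓ r)`, is a
`(12, 6)` potential. [folklore] -/
theorem smul_lennardJones_comp_mul (μ ℓ : ℝ) :
    (fun r => μ * Literature.MathematicalPhysics.StatisticalMechanics.lennardJones (ℓ * r)) =
      lennardJonesWith (μ / 12 * ℓ⁻¹ ^ 12) (μ / 6 * ℓ⁻¹ ^ 6) := by
  funext r
  simp only [Literature.MathematicalPhysics.StatisticalMechanics.lennardJones, lennardJonesWith, mul_inv, mul_pow]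
  ring

/-- `V''(r) = 156 A r⁻¹⁴ - 42 B r⁻⁸` for `V = A r⁻¹² - B r⁻⁶` and `r ≠ 0` (as an iterated
Fréchet/`deriv` derivative of the globally defined function). [folklore] -/
theorem iter_deriv_two_lennardJonesWith (A B : ℝ) {r : ℝ} (hr : r ≠ 0) :
    deriv^[2] (lennardJonesWith A B) r = 156 * A * r⁻¹ ^ 14 - 42 * B * r⁻¹ ^ 8 := by
  have e12 : (fun s : ℝ => s⁻¹ ^ 12) = fun s => s ^ (-12 : ℤ) := by
    funext s; rw [zpow_neg, zpow_ofNat, inv_pow]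
  have e6 : (fun s : ℝ => s⁻¹ ^ 6) = fun s => s ^ (-6 : ℤ) := by
    funext s; rw [zpow_neg, zpow_ofNat, inv_pow]
  have h12 : ContDiffAt ℝ 2 (fun s : ℝ => A * s⁻¹ ^ 12) r :=
    contDiffAt_const.mul ((contDiffAt_inv ℝ hr).pow 12)
  have h6 : ContDiffAt ℝ 2 (fun s : ℝ => B * s⁻¹ ^ 6) r :=
    contDiffAt_const.mul ((contDiffAt_inv ℝ hr).pow 6)
  have hV : lennardJonesWith A B = fun s => A * s⁻¹ ^ 12 - B * s⁻¹ ^ 6 := rfl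
  rw [hV, ← iteratedDeriv_eq_iterate, iteratedDeriv_fun_sub h12 h6,
    iteratedDeriv_const_mul_field, iteratedDeriv_const_mul_field, e12, e6,
    iteratedDeriv_eq_iterate, iteratedDeriv_eq_iterate, iter_deriv_zpow, iter_deriv_zpow]
  simp [Finset.prod_range_succ]
  norm_num
  field_simp
  ring

/-- `(1 + s)¹⁴ ≥ 1 + 14 s + 91 s²` for `s ≥ 0` (first three binomial terms). [folklore] -/
theorem one_add_pow_fourteen_ge {s : ℝ} (hs : 0 ≤ s) :
    1 + 14 * s + 91 * s ^ 2 ≤ (1 + s) ^ 14 := by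
  have h : (1 + s) ^ 14 = 1 + 14 * s + 91 * s ^ 2 + s ^ 3 * (364 + 1001 * s + 2002 * s ^ 2 +
      3003 * s ^ 3 + 3432 * s ^ 4 + 3003 * s ^ 5 + 2002 * s ^ 6 + 1001 * s ^ 7 + 364 * s ^ 8 +
      91 * s ^ 9 + 14 * s ^ 10 + s ^ 11) := by ring
  have : 0 ≤ s ^ 3 * (364 + 1001 * s + 2002 * s ^ 2 +
      3003 * s ^ 3 + 3432 * s ^ 4 + 3003 * s ^ 5 + 2002 * s ^ 6 + 1001 * s ^ 7 + 364 * s ^ 8 +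
      91 * s ^ 9 + 14 * s ^ 10 + s ^ 11) := by positivity
  rw [h]; linarith

/-! ## Theil 2006: no `(12, 6)` potential satisfies hypotheses (1)–(5), for any `α` -/

namespace Theil2006

/-- The quantitative incompatibility of (3) and (5) on the Lennard-Jones sign pattern
`A > 0`-free form: from (3) at `r = 1 + 9α/10` (with `B ≥ 0`) and (5) at `r = 2` (lower bound)
and `r = 27/20` (upper bound) one gets `(1 + 9α/10)¹⁴ ≤ 156 A ≤ 22.4 α`, impossible. [folklore] -/
theorem convex_decay_incompatible {a A B : ℝ} (ha : 0 < a) (hB : 0 ≤ B)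
    (h3 : 1 ≤ 156 * A * (1 + 9 * a / 10)⁻¹ ^ 14 - 42 * B * (1 + 9 * a / 10)⁻¹ ^ 8)
    (h5a : -(a * (2 : ℝ)⁻¹ ^ 7) ≤ 156 * A * (2 : ℝ)⁻¹ ^ 14 - 42 * B * (2 : ℝ)⁻¹ ^ 8)
    (h5b : 156 * A * (27 / 20 : ℝ)⁻¹ ^ 14 - 42 * B * (27 / 20 : ℝ)⁻¹ ^ 8 ≤
      a * (27 / 20 : ℝ)⁻¹ ^ 7) : False := by
  set r := 1 + 9 * a / 10 with hr
  have hr0 : 0 < r := by rw [hr]; positivity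
  have hri : r⁻¹ ^ 14 * r ^ 14 = 1 := by rw [← mul_pow, inv_mul_cancel₀ hr0.ne', one_pow]
  have h8 : 0 ≤ 42 * B * r⁻¹ ^ 8 := by positivity
  have h14 : r ^ 14 ≤ 156 * A := by
    have h1 : 1 ≤ 156 * A * r⁻¹ ^ 14 := by linarith
    calc r ^ 14 ≤ 156 * A * r⁻¹ ^ 14 * r ^ 14 := by nlinarith [pow_pos hr0 14]
      _ = 156 * A := by rw [mul_assoc, hri, mul_one]
  have hb : 1 + 14 * (9 * a / 10) + 91 * (9 * a / 10) ^ 2 ≤ r ^ 14 :=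
    one_add_pow_fourteen_ge (by positivity)
  norm_num at h5a h5b
  nlinarith [sq_nonneg (a - 1 / 15)]

/-- The same for the reversed sign pattern `A < 0`, `B < 0` (attractive core, repulsive `r⁻⁶`
tail): (3) at `r = 1 + 9α/10` gives `-42 B ≥ (1 + 9α/10)⁸ ≥ 1 + 7.2 α`, while (5) at `r = 2`
(upper bound) and `r = 27/20` (lower bound) gives `-42 B ≤ 2.35 α`. [folklore] -/
theorem convex_decay_incompatible_neg {a A B : ℝ} (ha : 0 < a) (hA : A < 0) (hB : B < 0)
    (h3 : 1 ≤ 156 * A * (1 + 9 * a / 10)⁻¹ ^ 14 - 42 * B * (1 + 9 * a / 10)⁻¹ ^ 8)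
    (h5a : 156 * A * (2 : ℝ)⁻¹ ^ 14 - 42 * B * (2 : ℝ)⁻¹ ^ 8 ≤ a * (2 : ℝ)⁻¹ ^ 7)
    (h5b : -(a * (27 / 20 : ℝ)⁻¹ ^ 7) ≤
      156 * A * (27 / 20 : ℝ)⁻¹ ^ 14 - 42 * B * (27 / 20 : ℝ)⁻¹ ^ 8) : False := by
  set r := 1 + 9 * a / 10 with hr
  have hr0 : 0 < r := by rw [hr]; positivity
  have hri : r⁻¹ ^ 8 * r ^ 8 = 1 := by rw [← mul_pow, inv_mul_cancel₀ hr0.ne', one_pow]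
  have h14 : 156 * A * r⁻¹ ^ 14 ≤ 0 := by
    have : 0 ≤ r⁻¹ ^ 14 := by positivity
    nlinarith
  have h8 : r ^ 8 ≤ -(42 * B) := by
    have h1 : 1 ≤ -(42 * B) * r⁻¹ ^ 8 := by linarith
    calc r ^ 8 ≤ -(42 * B) * r⁻¹ ^ 8 * r ^ 8 := by nlinarith [pow_pos hr0 8]
      _ = -(42 * B) := by rw [mul_assoc, hri, mul_one]
  have hb : 1 + 8 * (9 * a / 10) ≤ r ^ 8 := by
    rw [hr]
    exact (one_add_mul_le_pow (by linarith) 8).trans_eq' (by ring)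
  norm_num at h5a h5b
  nlinarith

/-- **No `(12, 6)` potential is admissible for Theil's Theorem 1.1, whatever the parameter `α`
and the coefficients `A, B`.** For the Lennard-Jones sign pattern (`A > 0`, `B ≥ 0`) and
`α > 0` only hypotheses (3) (`V'' ≥ 1` on `(1-α, 1+α)`) and (5) (`|V''(r)| ≤ α r⁻⁷` for
`r > 4/3`) are used (`convex_decay_incompatible`). [cite: Theil2006, §1 Theorem 1.1 (1), (3), (5)]
[cite: BlancLewin2015, §2.3 (arXiv p. 7)] [cite: Betermin2023, §1 (arXiv p. 3)] -/
theorem not_isAdmissible_lennardJonesWith (α A B : ℝ) :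
    ¬ Literature.MathematicalPhysics.StatisticalMechanics.Theil2006.IsAdmissible α (lennardJonesWith A B) := by
  intro hV
  -- (5) in closed form
  have h5 : ∀ r : ℝ, 4 / 3 < r →
      |156 * A * r⁻¹ ^ 14 - 42 * B * r⁻¹ ^ 8| ≤ α * r⁻¹ ^ 7 := fun r hr => by
    rw [← iter_deriv_two_lennardJonesWith A B (by positivity)]
    exact hV.decay r hr
  rcases le_or_gt α 0 with hα | hα
  · -- `α ≤ 0`: (5) forces `V'' = 0` on `(4/3, ∞)`, hence `A = B = 0`, contradicting (1).
    have z : ∀ r : ℝ, 4 / 3 < r → 156 * A * r⁻¹ ^ 14 - 42 * B * r⁻¹ ^ 8 = 0 := fun r hr => by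
      have h0 : α * r⁻¹ ^ 7 ≤ 0 :=
        mul_nonpos_of_nonpos_of_nonneg hα (by positivity)
      exact abs_nonpos_iff.mp ((h5 r hr).trans h0)
    have z2 := z 2 (by norm_num)
    have z3 := z 3 (by norm_num)
    norm_num at z2 z3
    have hA : A = 0 := by linarith
    have hB : B = 0 := by linarith
    have h1 := hV.latticeSum_one
    subst hA hB
    simp [Literature.MathematicalPhysics.StatisticalMechanics.Theil2006.latticeSum] at h1
  · -- `α > 0`: (3) at `r = 1 + 9α/10`.
    have h3 := hV.convex (1 + 9 * α / 10) ⟨by linarith, by linarith⟩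
    rw [iter_deriv_two_lennardJonesWith A B (by positivity)] at h3
    rcases le_or_gt 0 B with hB | hB
    · exact convex_decay_incompatible hα hB h3 (abs_le.mp (h5 2 (by norm_num))).1
        (abs_le.mp (h5 (27 / 20) (by norm_num))).2
    rcases le_or_gt 0 A with hA | hA
    · -- `B < 0 ≤ A`: `V ≥ 0`, contradicting `∑_{ξ ≠ 0} V(|ξ|) = -6`.
      have hnn : ∀ r : ℝ, 0 ≤ lennardJonesWith A B r := fun r => by
        have h12 : 0 ≤ A * r⁻¹ ^ 12 := by positivity
        have h6 : 0 ≤ -B * r⁻¹ ^ 6 := mul_nonneg (by linarith) (by positivity)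
        simp only [lennardJonesWith_apply]
        linarith
      have h0 : 0 ≤ Literature.MathematicalPhysics.StatisticalMechanics.Theil2006.latticeSum (lennardJonesWith A B) 1 := tsum_nonneg fun k => hnn _
      have h1 := hV.latticeSum_one
      linarith
    · exact convex_decay_incompatible_neg hα hA hB h3 (abs_le.mp (h5 2 (by norm_num))).2
        (abs_le.mp (h5 (27 / 20) (by norm_num))).1

/-- In particular the Lennard-Jones potential of the `AtomisticToContinuum` statement is not
Theil-admissible for any `α`. [cite: Theil2006, §1 Theorem 1.1] -/
theorem not_isAdmissible_lennardJones (α : ℝ) : ¬ Literature.MathematicalPhysics.StatisticalMechanics.Theil2006.IsAdmissible α Literature.MathematicalPhysics.StatisticalMechanics.lennardJones := by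
  rw [lennardJones_eq_lennardJonesWith]; exact not_isAdmissible_lennardJonesWith α _ _

/-- Nor is any multiple of any dilation `r ↦ μ V_LJ(ℓ r)` (the normalization (1) cannot be
bought by rescaling lengths and energies). [cite: Theil2006, §1 Theorem 1.1] -/
theorem not_isAdmissible_smul_lennardJones_comp_mul (α μ ℓ : ℝ) :
    ¬ Literature.MathematicalPhysics.StatisticalMechanics.Theil2006.IsAdmissible α (fun r => μ * Literature.MathematicalPhysics.StatisticalMechanics.lennardJones (ℓ * r)) := by
  rw [smul_lennardJones_comp_mul]; exact not_isAdmissible_lennardJonesWith α _ _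

end Theil2006

/-! ## Flatley–Theil 2015, Definition 2.1: `α`-localized potentials `(V, Ψ) ∈ Y_α` -/

namespace FlatleyTheil2015

/-- Euclidean `ℝ³`. [folklore] -/
abbrev Space : Type := EuclideanSpace ℝ (Fin 3)

/-- The generators `b₁ = (0,1,1)/√2`, `b₂ = (1,0,1)/√2`, `b₃ = (1,1,0)/√2` of the fcc lattice
`L_fcc = (b₁ b₂ b₃) ℤ³` (nearest-neighbour distance `1`). [cite: FlatleyTheil2015, §1 (arXiv p. 3)] -/
def fccVec : Fin 3 → Space :=
  ![(√2)⁻¹ • !₂[0, 1, 1], (√2)⁻¹ • !₂[1, 0, 1], (√2)⁻¹ • !₂[1, 1, 0]]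

/-- The labelling `ℤ³ → L_fcc`, `a ↦ a₁ b₁ + a₂ b₂ + a₃ b₃ = (a₂ + a₃, a₁ + a₃, a₁ + a₂)/√2`
(written in coordinates; `fccPoint_eq_sum`), an injective additive map onto
`L_fcc = (b₁ b₂ b₃) ℤ³`. [cite: FlatleyTheil2015, §1 (arXiv p. 3)] -/
def fccPoint : (Fin 3 → ℤ) →+ Space where
  toFun a := !₂[((a 1 + a 2 : ℤ) : ℝ) / √2, ((a 0 + a 2 : ℤ) : ℝ) / √2, ((a 0 + a 1 : ℤ) : ℝ) / √2]
  map_zero' := by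
    ext i; fin_cases i <;> simp
  map_add' a a' := by
    ext i; fin_cases i <;> (simp; ring)

/-- The fcc lattice `L_fcc = (b₁ b₂ b₃) ℤ³ ⊂ ℝ³` of Flatley–Theil (the asserted ground-state
geometry of Theorem 1.1). [cite: FlatleyTheil2015, §1 (arXiv p. 3)] -/
def fccLattice : Set Space := Set.range fccPoint

/-- First coordinate `(a₂ + a₃)/√2` of `a₁ b₁ + a₂ b₂ + a₃ b₃`. [folklore] -/
@[simp] theorem fccPoint_apply_zero (a : Fin 3 → ℤ) : fccPoint a 0 = (a 1 + a 2 : ℝ) / √2 := by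
  simp [fccPoint]

/-- Second coordinate `(a₁ + a₃)/√2` of `a₁ b₁ + a₂ b₂ + a₃ b₃`. [folklore] -/
@[simp] theorem fccPoint_apply_one (a : Fin 3 → ℤ) : fccPoint a 1 = (a 0 + a 2 : ℝ) / √2 := by
  simp [fccPoint]

/-- Third coordinate `(a₁ + a₂)/√2` of `a₁ b₁ + a₂ b₂ + a₃ b₃`. [folklore] -/
@[simp] theorem fccPoint_apply_two (a : Fin 3 → ℤ) : fccPoint a 2 = (a 0 + a 1 : ℝ) / √2 := by
  simp [fccPoint]

/-- `fccPoint a = ∑ᵢ aᵢ bᵢ` with Flatley–Theil's generators. [cite: FlatleyTheil2015, §1 (arXiv p. 3)] -/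
theorem fccPoint_eq_sum (a : Fin 3 → ℤ) : fccPoint a = ∑ i, (a i : ℝ) • fccVec i := by
  ext i
  fin_cases i <;> (simp [fccVec, Fin.sum_univ_three, div_eq_mul_inv]; ring)

/-- `|a₁ b₁ + a₂ b₂ + a₃ b₃|² = ((a₂+a₃)² + (a₁+a₃)² + (a₁+a₂)²)/2`. [folklore] -/
theorem norm_fccPoint_sq (a : Fin 3 → ℤ) :
    ‖fccPoint a‖ ^ 2 = (((a 1 + a 2) ^ 2 + (a 0 + a 2) ^ 2 + (a 0 + a 1) ^ 2 : ℤ) : ℝ) / 2 := by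
  rw [EuclideanSpace.norm_sq_eq, Fin.sum_univ_three, Real.norm_eq_abs, Real.norm_eq_abs,
    Real.norm_eq_abs, sq_abs, sq_abs, sq_abs, fccPoint_apply_zero, fccPoint_apply_one,
    fccPoint_apply_two, div_pow, div_pow, div_pow, Real.sq_sqrt (by norm_num : (0:ℝ) ≤ 2)]
  push_cast
  ring

/-- `b₁ = fccPoint e₁` is a lattice vector of length `1`: the nearest-neighbour distance of
`L_fcc` is normalised to `1` ("Assumption `V(1) = -1` sets the lattice parameter to 1").
[cite: FlatleyTheil2015, §2.1] -/
theorem norm_fccPoint_single : ‖fccPoint ![1, 0, 0]‖ = 1 := by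
  have h : ‖fccPoint ![1, 0, 0]‖ ^ 2 = 1 := by
    rw [norm_fccPoint_sq]; simp [Matrix.cons_val_two, Matrix.tail_cons, Matrix.head_cons]
  have h0 := norm_nonneg (fccPoint ![1, 0, 0])
  nlinarith

/-- The labelling `ℤ³ → L_fcc` is injective. [folklore] -/
theorem fccPoint_injective : Function.Injective fccPoint := by
  refine (injective_iff_map_eq_zero fccPoint).2 fun a ha => ?_
  have h := norm_fccPoint_sq a
  rw [ha, norm_zero] at h
  have h' : ((a 1 + a 2) ^ 2 + (a 0 + a 2) ^ 2 + (a 0 + a 1) ^ 2 : ℤ) = 0 := by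
    have : (((a 1 + a 2) ^ 2 + (a 0 + a 2) ^ 2 + (a 0 + a 1) ^ 2 : ℤ) : ℝ) = 0 := by linarith
    exact_mod_cast this
  have h1 : a 1 + a 2 = 0 := by nlinarith [sq_nonneg (a 1 + a 2), sq_nonneg (a 0 + a 2), sq_nonneg (a 0 + a 1)]
  have h2 : a 0 + a 2 = 0 := by nlinarith [sq_nonneg (a 1 + a 2), sq_nonneg (a 0 + a 2), sq_nonneg (a 0 + a 1)]
  have h3 : a 0 + a 1 = 0 := by nlinarith [sq_nonneg (a 1 + a 2), sq_nonneg (a 0 + a 2), sq_nonneg (a 0 + a 1)]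
  funext i; fin_cases i <;> (simp; omega)

/-- The pair part `∑_{k ∈ L_fcc∖{0}} V(r|k|)` of the renormalized energy `E_fcc(r)` of the
homogeneously dilated lattice `r L_fcc` (Flatley–Theil, Theorem 1.1 and §2.2; a `tsum`, junk
`0` if not summable — `IsLocalizedPair` requires summability for `r > 0`).
[cite: FlatleyTheil2015, §1 Theorem 1.1 (definition of `E_fcc`)] -/
def fccLatticeSum (V : ℝ → ℝ) (r : ℝ) : ℝ :=
  ∑' a : {a : Fin 3 → ℤ // a ≠ 0}, V (r * ‖fccPoint a.1‖)

/-- **Item 1 of Flatley–Theil's Definition 2.1** (the pair potential `V` of an `α`-localized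
pair `(V, Ψ) ∈ Y_α ⊂ C¹([0,∞)) × C¹([0,∞)³)`): `V ∈ C¹([0,∞))`, `lim_{r→∞} V(r) = 0`,
`V(1) = -1`, `min_{r>0} ∑_{k ∈ L_fcc∖{0}} (V(r|k|) - V(|k|)) = 0` (with the lattice sums
summable, see the module docstring), and
`V(√(8/3)) - 3 V(√3) ≥ α^{1/2}`, `V(r) ≥ 1/α` for `r ∈ [0, 1-α]`, `V''(r) ≥ 1` for
`r ∈ (1-α, 1+α)`, `V'(√3) ≥ 0`, `|V''(r)| ≤ α^{1/4}` for `r ∈ [1+α, √(7/2)]`,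
`|V''(r)| ≤ α r⁻¹⁰` for `r ∈ [√(7/2), ∞)`. [cite: FlatleyTheil2015, §2 Definition 2.1 (item 1)] -/
structure IsLocalizedPair (α : ℝ) (V : ℝ → ℝ) : Prop where
  /-- `V ∈ C¹([0, ∞))` -/
  contDiffOn : ContDiffOn ℝ 1 V (Ici 0)
  /-- `V(r) → 0` as `r → ∞` -/
  tendsto_zero : Tendsto V atTop (𝓝 0)
  /-- normalization `V(1) = -1` -/
  apply_one : V 1 = -1
  /-- the lattice sums `∑_{k ∈ L_fcc∖0} V(r|k|)` converge for `r > 0` -/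
  summable : ∀ r : ℝ, 0 < r → Summable fun a : {a : Fin 3 → ℤ // a ≠ 0} => V (r * ‖fccPoint a.1‖)
  /-- `min_{r>0} ∑_{k} (V(r|k|) - V(|k|)) = 0`: no dilation of `L_fcc` lowers the pair energy -/
  le_fccLatticeSum : ∀ r : ℝ, 0 < r → fccLatticeSum V 1 ≤ fccLatticeSum V r
  /-- fcc selection: `V(√(8/3)) - 3 V(√3) ≥ α^{1/2}` -/
  fcc_selection : Real.sqrt α ≤ V (√(8 / 3)) - 3 * V (√3)
  /-- `V(r) ≥ 1/α` on `[0, 1-α]` -/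
  core : ∀ r ∈ Icc (0 : ℝ) (1 - α), 1 / α ≤ V r
  /-- `V''(r) ≥ 1` on `(1-α, 1+α)` -/
  convex : ∀ r ∈ Ioo (1 - α) (1 + α), 1 ≤ deriv^[2] V r
  /-- `V'(√3) ≥ 0` -/
  deriv_sqrt_three_nonneg : 0 ≤ deriv V (√3)
  /-- `|V''(r)| ≤ α^{1/4}` on `[1+α, √(7/2)]` -/
  medium : ∀ r ∈ Icc (1 + α) (√(7 / 2)), |deriv^[2] V r| ≤ α ^ (1 / 4 : ℝ)
  /-- `|V''(r)| ≤ α r⁻¹⁰` on `[√(7/2), ∞)` -/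
  decay : ∀ r : ℝ, √(7 / 2) ≤ r → |deriv^[2] V r| ≤ α * r⁻¹ ^ 10

/-- **Item 2 of Flatley–Theil's Definition 2.1** (the three-body potential `Ψ` of
`(V, Ψ) ∈ Y_α`, a function of the three side lengths `(r₁, r₂, r₃) ∈ [0,∞)³`):
`Ψ ∈ C¹([0,∞)³)`, `min_{rᵢ ≥ 0} Ψ = Ψ(1,1,1) = -1`, `Ψ ≥ 0` if `maxᵢ |rᵢ - 1| ≥ α`,
`Ψ ≥ 1/α` if `minᵢ rᵢ ≤ 1-α` and `maxᵢ rᵢ < 4/3`, `Ψ = 0` if `maxᵢ rᵢ ≥ 7/5`.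
[cite: FlatleyTheil2015, §2 Definition 2.1 (item 2)] -/
structure IsLocalizedTriple (α : ℝ) (Ψ : (Fin 3 → ℝ) → ℝ) : Prop where
  /-- `Ψ ∈ C¹([0,∞)³)` -/
  contDiffOn : ContDiffOn ℝ 1 Ψ {r | ∀ i, 0 ≤ r i}
  /-- `Ψ(1,1,1) = -1` … -/
  apply_one : Ψ (fun _ => 1) = -1
  /-- … is the minimum of `Ψ` over `[0,∞)³` -/
  min : ∀ r : Fin 3 → ℝ, (∀ i, 0 ≤ r i) → -1 ≤ Ψ r
  /-- `Ψ ≥ 0` as soon as one side is `α`-far from `1` -/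
  nonneg : ∀ r : Fin 3 → ℝ, (∀ i, 0 ≤ r i) → (∃ i, α ≤ |r i - 1|) → 0 ≤ Ψ r
  /-- `Ψ ≥ 1/α` if `minᵢ rᵢ ≤ 1-α` and `maxᵢ rᵢ < 4/3` -/
  core : ∀ r : Fin 3 → ℝ, (∀ i, 0 ≤ r i) → (∃ i, r i ≤ 1 - α) → (∀ i, r i < 4 / 3) → 1 / α ≤ Ψ r
  /-- `Ψ = 0` if `maxᵢ rᵢ ≥ 7/5` (finite range) -/
  eq_zero : ∀ r : Fin 3 → ℝ, (∀ i, 0 ≤ r i) → (∃ i, 7 / 5 ≤ r i) → Ψ r = 0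

/-- `√(7/2) ≤ 2`. [folklore] -/
theorem sqrt_seven_halves_le_two : √(7 / 2 : ℝ) ≤ 2 :=
  Real.sqrt_le_iff.mpr ⟨by norm_num, by norm_num⟩

/-- **No `(12, 6)` potential is the pair part of an `α`-localized pair, whatever `α, A, B`.**
For `B ≠ 0` the van der Waals tail is too fat for the decay condition: `r⁸ V''(r) → -42 B ≠ 0`
while `|V''(r)| ≤ α r⁻¹⁰` forces `r⁸ |V''(r)| ≤ α r⁻² → 0`; for `B = 0`, `V(1) = -1` gives
`A = -1` and `V''(1) = -156 < 1` (resp. `V''(2) ≠ 0` if `α ≤ 0`).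
[cite: FlatleyTheil2015, §2 Definition 2.1 (item 1)] [cite: BlancLewin2015, §2.3 (arXiv p. 7)] -/
theorem not_isLocalizedPair_lennardJonesWith (α A B : ℝ) :
    ¬ IsLocalizedPair α (lennardJonesWith A B) := by
  intro hV
  have hs0 : 0 < √(7 / 2 : ℝ) := Real.sqrt_pos.mpr (by norm_num)
  have hd : ∀ r : ℝ, √(7 / 2) ≤ r →
      |156 * A * r⁻¹ ^ 14 - 42 * B * r⁻¹ ^ 8| ≤ α * r⁻¹ ^ 10 := fun r hr => by
    rw [← iter_deriv_two_lennardJonesWith A B (hs0.trans_le hr).ne']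
    exact hV.decay r hr
  rcases eq_or_ne B 0 with rfl | hB
  · -- `B = 0`: `V(1) = -1` forces `A = -1`
    have h1 : A = -1 := by simpa using hV.apply_one
    subst h1
    rcases le_or_gt α 0 with hα | hα
    · have h2 := (hd 2 sqrt_seven_halves_le_two).trans
        (mul_nonpos_of_nonpos_of_nonneg hα (by positivity))
      have := abs_nonpos_iff.mp h2
      norm_num at this
    · have h3 := hV.convex 1 ⟨by linarith, by linarith⟩
      rw [iter_deriv_two_lennardJonesWith _ _ one_ne_zero] at h3
      norm_num at h3
  · -- `B ≠ 0`: the `r⁻⁶` tail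
    have hlim : Tendsto (fun r : ℝ => |156 * A * r⁻¹ ^ 6 - 42 * B| - α * r⁻¹ ^ 2) atTop
        (𝓝 (|156 * A * (0 : ℝ) ^ 6 - 42 * B| - α * (0 : ℝ) ^ 2)) := by
      have h := tendsto_inv_atTop_zero (𝕜 := ℝ)
      exact (((tendsto_const_nhds.mul (h.pow 6)).sub tendsto_const_nhds).abs).sub
        (tendsto_const_nhds.mul (h.pow 2))
    have hpos : (0 : ℝ) < |42 * B| := abs_pos.mpr (mul_ne_zero (by norm_num) hB)
    have hlt : |156 * A * (0 : ℝ) ^ 6 - 42 * B| - α * (0 : ℝ) ^ 2 ∈ Ioi (|42 * B| / 2) := by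
      simp only [mem_Ioi, zero_pow (n := 6) (by norm_num), zero_pow (n := 2) (by norm_num),
        mul_zero, zero_sub, abs_neg, sub_zero]
      linarith
    obtain ⟨r, hr₁, hr₂⟩ :=
      ((hlim.eventually (Ioi_mem_nhds hlt)).and (eventually_ge_atTop (√(7 / 2)))).exists
    have hr0 : 0 < r := hs0.trans_le hr₂
    have key := hd r hr₂
    have hfac : 156 * A * r⁻¹ ^ 14 - 42 * B * r⁻¹ ^ 8 = r⁻¹ ^ 8 * (156 * A * r⁻¹ ^ 6 - 42 * B) := by
      ring
    rw [hfac, abs_mul, abs_of_pos (by positivity : (0 : ℝ) < r⁻¹ ^ 8),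
      show α * r⁻¹ ^ 10 = r⁻¹ ^ 8 * (α * r⁻¹ ^ 2) by ring] at key
    have key' : |156 * A * r⁻¹ ^ 6 - 42 * B| ≤ α * r⁻¹ ^ 2 :=
      le_of_mul_le_mul_left key (by positivity)
    have : |42 * B| / 2 < |156 * A * r⁻¹ ^ 6 - 42 * B| - α * r⁻¹ ^ 2 := hr₁
    linarith [abs_nonneg (42 * B)]

/-- In particular not the Lennard-Jones potential of the `AtomisticToContinuum` statement, nor any
`r ↦ μ V_LJ(ℓ r)`. [cite: FlatleyTheil2015, §2 Definition 2.1] -/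
theorem not_isLocalizedPair_smul_lennardJones_comp_mul (α μ ℓ : ℝ) :
    ¬ IsLocalizedPair α (fun r => μ * Literature.MathematicalPhysics.StatisticalMechanics.lennardJones (ℓ * r)) := by
  rw [smul_lennardJones_comp_mul]; exact not_isLocalizedPair_lennardJonesWith α _ _

/-- The Lennard-Jones potential of the tree is not the pair part of an `α`-localized pair.
[cite: FlatleyTheil2015, §2 Definition 2.1] -/
theorem not_isLocalizedPair_lennardJones (α : ℝ) : ¬ IsLocalizedPair α Literature.MathematicalPhysics.StatisticalMechanics.lennardJones := by
  rw [lennardJones_eq_lennardJonesWith]; exact not_isLocalizedPair_lennardJonesWith α _ _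

/-- **Theorem 1.1 of Flatley–Theil has no pure pair-potential instance**: the three-body
potential `Ψ = 0` is not admissible (`Ψ(1,1,1) = -1` is required) — "The role of the three-body
potential `V₃` is of solely a technical nature. It is quite likely that the assumptions of
Theorem 1.1 can be relaxed so that also pure pair models are covered"; "this remains an open
problem". [cite: FlatleyTheil2015, §2 Definition 2.1 (item 2), §1 (arXiv p. 4), §2.1 (p. 7)] -/
theorem not_isLocalizedTriple_zero (α : ℝ) : ¬ IsLocalizedTriple α 0 := fun h => by
  have := h.apply_one
  norm_num at this

end FlatleyTheil2015

/-! ## The barrier -/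

/-- **Barrier (localized-potential hypotheses exclude Lennard-Jones; seed "only 2D results
(Theil)").** The proved crystallization theorems for Lennard-Jones-*like* pair potentials —
Theil 2006 (triangular lattice, `d = 2`, Theorems 1.1–1.3 under hypotheses (1)–(5) with one small
parameter `α`) and its three-dimensional descendant Flatley–Theil 2015 (fcc, Theorem 1.1, for
`α`-localized pairs `(V₂, V₃)` with a Stillinger–Weber-type three-body term) — cannot be
applied to the Lennard-Jones potential `V_LJ` of `Literature.MathematicalPhysics.StatisticalMechanics.Crystallization`, to any multiple
of any dilation of it, or to any `(12, 6)` potential `A r⁻¹² - B r⁻⁶`: for every value of the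
parameter `α`, (i) `V` violates Theil's hypotheses (`Theil2006.IsAdmissible`), (ii) `V` is not
the pair part of a Flatley–Theil `α`-localized pair (`FlatleyTheil2015.IsLocalizedPair`), and
(iii) the pure pair model `V₃ = 0` is not in Flatley–Theil's class at all
(`FlatleyTheil2015.IsLocalizedTriple`).

BARRIER (D-0021; every clause is a citation, not an assessment)
* technique_class: alpha-localized-pair-potential narrow-well sticky-disc-perturbation (theorems whose hypotheses confine the well of `V` to an `α`-neighbourhood of the bond length and make `V''` `α`-small beyond it: `Theil2006.IsAdmissible α`, `FlatleyTheil2015.IsLocalizedPair α` / `IsLocalizedTriple α`)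
* blocks: obtaining `Literature.StatMech.HasPeriodicGroundStateEnergy lennardJones 3`, `Literature.StatMech.IsCrystallizing lennardJones 3`, or their two-dimensional analogues for `V_LJ`, by instantiating the existing theorems — Theil 2006 Thm 1.1/1.2/1.3 (tree facts `Theil2006_groundStateEnergy`, `Theil2006_periodicGroundStates`, `Theil2006_dirichletGroundStates`, all in `ℝ²`) [cite: Theil2006, §1 Theorem 1.1] and Flatley–Theil 2015 Thm 1.1 (`ℝ³`, with three-body term) [cite: FlatleyTheil2015, §1 Theorem 1.1] — with `V = μ V_LJ(ℓ ·)` for some scaling: "he still used restrictive hypotheses on `V`" [cite: BlancLewin2015, §2.3 (arXiv p. 7)]; the proved pairwise results need potentials that "are strongly repulsive at the origin and have very narrow wells (… in order to catch only the nearest-neighbors) … before converging rapidly to zero" [cite: Betermin2023, §1 (arXiv p. 3)]; for the Lennard-Jones energy "even in dimension `d = 2` crystallization of minimizers has not been proved rigorously" [cite: LucaFriesecke2016, §1 (arXiv p. 3)]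
* because: for `V = A r⁻¹² - B r⁻⁶`, `V'' = 156 A r⁻¹⁴ - 42 B r⁻⁸`; Theil's (3) `V'' ≥ 1` on `(1-α, 1+α)` at `r = 1 + 9α/10` forces `156 A ≥ (1 + 9α/10)¹⁴` (`B ≥ 0`), while (5) `|V''(r)| ≤ α r⁻⁷` on `(4/3, ∞)` at `r = 27/20, 2` forces `156 A ≤ 22.4 α`, and `(1 + 9α/10)¹⁴ ≥ 1 + 12.6 α + 73.7 α² > 22.4 α` for every `α > 0` — the curvature at the well and the softness of the tail are tied to the same `α`, which a homogeneous two-term potential cannot satisfy (this file, `Theil2006.not_isAdmissible_lennardJonesWith`) [cite: Theil2006, §1 Theorem 1.1 (3), (5)]; Flatley–Theil's decay `|V''(r)| ≤ α r⁻¹⁰` on `[√(7/2), ∞)` ("medium and long-range interactions are much weaker than the short-range interactions") is violated by any `r⁻⁶` tail, `r⁸ V''(r) → -42 B`, and their three-body item requires `Ψ(1,1,1) = -1 ≠ 0` (this file, `FlatleyTheil2015.not_isLocalizedPair_lennardJonesWith`, `not_isLocalizedTriple_zero`) [cite: FlatleyTheil2015, §2 Definition 2.1 and §2.1]; the admissible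 classes perturb the sticky-disc / Heitmann–Radin potential, the `p → ∞` "brittle limit" of Lennard-Jones `(p, 2p)` "in which the width of the well of the pair potential is compressed to zero" [cite: LucaFriesecke2016, §1 (arXiv p. 3)]
* evasions_known: (i) `d = 1`: the Lennard-Jones ground state is proved periodic (Gardner–Radin 1979) [cite: BlancLewin2015, §2.3 (arXiv p. 7)]; (ii) restrict the competitors to Bravais lattices: the triangular lattice minimises the classical Lennard-Jones lattice energy among two-dimensional lattices (computer-assisted) [cite: Betermin2023, §1 Theorem 1.1] and at fixed high density (Bétermin–Zhang) [cite: BlancLewin2015, §2.5 (arXiv p. 10)] — lattice optimality, not crystallization; (iii) pass to the brittle limit `p → ∞` (Heitmann–Radin, De Luca–Friesecke: sticky-disc ground states are subsets of the triangular lattice) [cite: LucaFriesecke2016, §1 (arXiv pp. 2–3)]; (iv) Flatley–Theil: "It is quite likely that the assumptions of Theorem 1.1 can be relaxed so that also pure pair models are covered", "it is possible to relax [`V'' ≥ 1` near `1`] and [the decay] at the expense of additional assumptions", and Conjecture 2.2 as "a possible route to eliminate the necessity of `V₃`" — announced, not proved [cite: FlatleyTheil2015, §1 (arXiv p. 4),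 §2.1 (p. 7)]; (v) certified numerics for the genuine `(12, 6)` potential at fixed `N` in `d = 3`: next to the relaxed `864`-atom fcc block there is a true local minimizer of the Lennard-Jones energy (interval-arithmetic validation, "‖p - p̄‖∞ ≤ 1.4797·10⁻¹¹ … unique within distance 9.9994·10⁻⁸"), likewise with one vacancy (Theorem 4.2) and for a `256`-atom periodic cell (Theorem 4.4) — existence of a locally unique local minimizer at finite `N`, not a ground-state or `N → ∞` statement [cite: AyalaChoksiWirth2025, §4 Theorems 4.1, 4.2, 4.4]; (vi) a second long-range localized class in `d = 2` — one-well potentials with `V > -1/2` off `(1-α, √2+α)` and tail `|V''(r)| ≤ ε r^{-p-2}`, `p > 4`, `ε` small — is proved to crystallize, on the square lattice `t ℤ²` (again narrow-well/small-tail hypotheses, and the wrong lattice for `V_LJ`) [cite: BeterminDelucaPetrache2021, §1.2 Theorem 1.3, §1.5 (6')]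
* scope_caveats: what is proved here is non-membership of the `(12, 6)` family in two hypothesis classes as transcribed in Lean (the tree's soft-core real-valued reading of Theil's (1)–(5); items 1–2 of Flatley–Theil's Definition 2.1 with explicit summability); it does not show that the CONCLUSIONS of Theil 2006 or Flatley–Theil 2015 fail for Lennard-Jones, nor that their proofs cannot be modified (Flatley–Theil expect they can, §1 p. 4), nor anything about other exponents `(p, q)`, about E–Li 2009's hypothesis class (paper not held, acq-00476) or the square-lattice class of Bétermin–De Luca–Petrache; the quoted "restrictive hypotheses" / "very narrow wells" sentences are descriptions of the literature, not impossibility theorems [cite: BlancLewin2015, §2.3] [cite: Betermin2023, §1]; (audit 2026-08-15) other exponents are partly covered after all: the structural content of (ii) is the decay exponent alone — every `V` with `rᵏ V''(r) → c ≠ 0`, `k < 10`, hence every Mie potential `A r⁻ᵖ - B r^{-q}` with `0 < q < 8`, `q < p` and all `α, A, B`, is outside `IsLocalizedPair α` (this file, `FlatleyTheil2015.not_isLocalizedPair_mieWith`), whereas Theil's exponent `7` excludes only tails with `k < 7` structurally (this file, `Theil2006.not_isAdmissible_of_tendsto_pow_mul_deriv2`), the `(12, 6)` case of (i) being quantitative;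 Theil's hypotheses are restated as (i)–(v) in [cite: BeterminDelucaPetrache2021, §1.4], matching `Theil2006.IsAdmissible`, while the paper itself and E–Li 2009 remain cite-only (acq-00256, acq-00476)
* status: established (theorem: `LocalizedPotentialsExcludeLennardJones_holds`, proved in this file from Mathlib calculus and the tree's `Theil2006.IsAdmissible`)

[cite: Theil2006, §1 Theorem 1.1] [cite: FlatleyTheil2015, §2 Definition 2.1]
[cite: BlancLewin2015, §2.3 (arXiv p. 7)] [cite: Betermin2023, §1 (arXiv p. 3)]
[cite: LucaFriesecke2016, §1 (arXiv p. 3)] -/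
def LocalizedPotentialsExcludeLennardJones : Prop :=
  (∀ α A B : ℝ, ¬ Literature.MathematicalPhysics.StatisticalMechanics.Theil2006.IsAdmissible α (lennardJonesWith A B)) ∧
    (∀ α A B : ℝ, ¬ FlatleyTheil2015.IsLocalizedPair α (lennardJonesWith A B)) ∧
      ∀ α : ℝ, ¬ FlatleyTheil2015.IsLocalizedTriple α 0

/-- The barrier holds. [cite: Theil2006, §1 Theorem 1.1 (3), (5)]
[cite: FlatleyTheil2015, §2 Definition 2.1] -/
theorem LocalizedPotentialsExcludeLennardJones_holds : LocalizedPotentialsExcludeLennardJones :=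
  ⟨Theil2006.not_isAdmissible_lennardJonesWith,
    FlatleyTheil2015.not_isLocalizedPair_lennardJonesWith,
    FlatleyTheil2015.not_isLocalizedTriple_zero⟩

/-- Corollary (Theil 2006): no scaling `r ↦ μ V_LJ(ℓ r)` of the Lennard-Jones potential is
admissible, for any `α`. [cite: Theil2006, §1 Theorem 1.1] -/
theorem LocalizedPotentialsExcludeLennardJones.theil (h : LocalizedPotentialsExcludeLennardJones)
    (α μ ℓ : ℝ) : ¬ Literature.MathematicalPhysics.StatisticalMechanics.Theil2006.IsAdmissible α (fun r => μ * Literature.MathematicalPhysics.StatisticalMechanics.lennardJones (ℓ * r)) := by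
  rw [smul_lennardJones_comp_mul]; exact h.1 α _ _

/-- Corollary (Flatley–Theil 2015): no scaling of the Lennard-Jones potential is the pair part of
an `α`-localized pair, for any `α`. [cite: FlatleyTheil2015, §2 Definition 2.1] -/
theorem LocalizedPotentialsExcludeLennardJones.flatleyTheil
    (h : LocalizedPotentialsExcludeLennardJones) (α μ ℓ : ℝ) :
    ¬ FlatleyTheil2015.IsLocalizedPair α (fun r => μ * Literature.MathematicalPhysics.StatisticalMechanics.lennardJones (ℓ * r)) := by
  rw [smul_lennardJones_comp_mul]; exact h.2.1 α _ _

/-! ## Audit 2026-08-15 (barrier audit, D-0021): the structural form of the decay obstruction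

The `(12, 6)` computations above are instances of two exponent counts, recorded here so that the
scope of clauses (i)–(ii) is explicit: Flatley–Theil's `|V''(r)| ≤ α r⁻¹⁰` excludes every potential
with `rᵏ V''(r) → c ≠ 0` for some `k < 10` (all inverse-power attractions `-B r^{-q}`, `q < 8`,
whatever the repulsion), Theil's `|V''(r)| ≤ α r⁻⁷` every such tail with `k < 7` (`q < 5`); the
van der Waals tail `q = 6` is thus excluded from Theil's class only quantitatively
(`Theil2006.not_isAdmissible_lennardJonesWith`). -/

/-! ### The Mie `(p, q)` family -/

/-- The Mie `(p, q)` inverse-power pair potential `V(r) = A r⁻ᵖ - B r^{-q}` with natural exponents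
(`lennardJonesWith A B = mieWith A B 12 6`). [cite: Betermin2023, §1 (arXiv p. 3)] -/
def mieWith (A B : ℝ) (p q : ℕ) (r : ℝ) : ℝ :=
  A * r⁻¹ ^ p - B * r⁻¹ ^ q

/-- Unfolding lemma. [folklore] -/
@[simp] theorem mieWith_apply (A B : ℝ) (p q : ℕ) (r : ℝ) :
    mieWith A B p q r = A * r⁻¹ ^ p - B * r⁻¹ ^ q := rfl

/-- The `(12, 6)` family is the Mie family at `p = 12`, `q = 6` (definitionally). [folklore] -/
theorem lennardJonesWith_eq_mieWith (A B : ℝ) : lennardJonesWith A B = mieWith A B 12 6 := rfl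

/-- `V''(r) = p(p+1) A r^{-(p+2)} - q(q+1) B r^{-(q+2)}` for `r ≠ 0`. [folklore] -/
theorem iter_deriv_two_mieWith (A B : ℝ) (p q : ℕ) {r : ℝ} (hr : r ≠ 0) :
    deriv^[2] (mieWith A B p q) r =
      (p * (p + 1) : ℝ) * A * r⁻¹ ^ (p + 2) - (q * (q + 1) : ℝ) * B * r⁻¹ ^ (q + 2) := by
  have e : ∀ n : ℕ, (fun s : ℝ => s⁻¹ ^ n) = fun s => s ^ (-(n : ℤ)) := fun n => by
    funext s; rw [zpow_neg, zpow_natCast, inv_pow]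
  have e' : ∀ n : ℕ, r ^ (-(n : ℤ) - 2) = r⁻¹ ^ (n + 2) := fun n => by
    rw [show (-(n : ℤ) - 2) = -((n + 2 : ℕ) : ℤ) by push_cast; ring, zpow_neg, zpow_natCast, inv_pow]
  have hp : ContDiffAt ℝ 2 (fun s : ℝ => A * s⁻¹ ^ p) r :=
    contDiffAt_const.mul ((contDiffAt_inv ℝ hr).pow p)
  have hq : ContDiffAt ℝ 2 (fun s : ℝ => B * s⁻¹ ^ q) r :=
    contDiffAt_const.mul ((contDiffAt_inv ℝ hr).pow q)
  have hV : mieWith A B p q = fun s => A * s⁻¹ ^ p - B * s⁻¹ ^ q := rfl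
  rw [hV, ← iteratedDeriv_eq_iterate, iteratedDeriv_fun_sub hp hq,
    iteratedDeriv_const_mul_field, iteratedDeriv_const_mul_field, e p, e q,
    iteratedDeriv_eq_iterate, iteratedDeriv_eq_iterate, iter_deriv_zpow, iter_deriv_zpow]
  simp only [Finset.prod_range_succ, Finset.prod_range_zero, one_mul, Nat.cast_ofNat, Int.cast_neg,
    Int.cast_natCast, Nat.cast_zero, sub_zero, Nat.cast_one]
  rw [e' p, e' q]
  ring


/-! ## Structural form of the decay obstructions: no van der Waals tail -/

namespace FlatleyTheil2015

/-- **Flatley–Theil's decay condition kills every tail `V'' ~ c r⁻ᵏ` with `k < 10`.** If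
`r ↦ rᵏ V''(r)` has a non-zero limit at infinity for some natural `k < 10`, then `V` is not the
pair part of an `α`-localized pair, for any `α`: the condition `|V''(r)| ≤ α r⁻¹⁰` on
`[√(7/2), ∞)` forces `rᵏ V''(r) = O(r^{k-10}) → 0`. With `k = q + 2` this covers every attraction
`-B r^{-q}`, `q < 8`, in particular the van der Waals tail `q = 6`, whatever the repulsive core.
[cite: FlatleyTheil2015, §2 Definition 2.1 (item 1), §2.1] -/
theorem not_isLocalizedPair_of_tendsto_pow_mul_deriv2 {α : ℝ} {V : ℝ → ℝ} {k : ℕ} {c : ℝ}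
    (hk : k < 10) (hc : c ≠ 0)
    (hlim : Tendsto (fun r : ℝ => r ^ k * deriv^[2] V r) atTop (𝓝 c)) :
    ¬ IsLocalizedPair α V := by
  intro hV
  have hs0 : 0 < √(7 / 2 : ℝ) := Real.sqrt_pos.mpr (by norm_num)
  -- eventually `|r^k V''(r)| ≤ |α| r⁻¹ ^ (10 - k)`
  have hbound : ∀ᶠ r : ℝ in atTop, |r ^ k * deriv^[2] V r| ≤ |α| * r⁻¹ ^ (10 - k) := by
    filter_upwards [eventually_ge_atTop (√(7 / 2 : ℝ))] with r hr
    have hr0 : 0 < r := hs0.trans_le hr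
    have hd := hV.decay r hr
    have hk' : r ^ k * r⁻¹ ^ 10 = r⁻¹ ^ (10 - k) := by
      have h10 : r⁻¹ ^ 10 = r⁻¹ ^ k * r⁻¹ ^ (10 - k) := by
        rw [← pow_add, Nat.add_sub_cancel' hk.le]
      rw [h10, ← mul_assoc, ← mul_pow, mul_inv_cancel₀ hr0.ne', one_pow, one_mul]
    calc |r ^ k * deriv^[2] V r| = r ^ k * |deriv^[2] V r| := by
          rw [abs_mul, abs_of_pos (pow_pos hr0 k)]
      _ ≤ r ^ k * (α * r⁻¹ ^ 10) := mul_le_mul_of_nonneg_left hd (pow_pos hr0 k).le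
      _ ≤ r ^ k * (|α| * r⁻¹ ^ 10) :=
          mul_le_mul_of_nonneg_left (mul_le_mul_of_nonneg_right (le_abs_self α) (by positivity))
            (pow_pos hr0 k).le
      _ = |α| * r⁻¹ ^ (10 - k) := by rw [← hk', mul_left_comm]
  have hzero : Tendsto (fun r : ℝ => |α| * r⁻¹ ^ (10 - k)) atTop (𝓝 0) := by
    have h := (tendsto_inv_atTop_zero (𝕜 := ℝ)).pow (10 - k)
    rw [zero_pow (by omega)] at h
    simpa using h.const_mul |α|
  have hlim0 : Tendsto (fun r : ℝ => r ^ k * deriv^[2] V r) atTop (𝓝 0) :=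
    squeeze_zero_norm' (by simpa only [Real.norm_eq_abs] using hbound) hzero
  exact hc (tendsto_nhds_unique hlim hlim0)

/-- **No Mie `(p, q)` potential with `0 < q < 8`, `q < p` is the pair part of an `α`-localized
pair, whatever `α, A, B`** (for `B ≠ 0`: `r^{q+2} V''(r) → -q(q+1) B ≠ 0`; for `B = 0`:
`V(1) = -1` forces `A = -1`, then `V''(1) = -p(p+1) < 1`, resp. `V''(2) ≠ 0` if `α ≤ 0`). This
extends clause (ii) of the barrier from `(12, 6)` to every inverse-power attraction slower than
`r⁻⁸`, independently of the repulsive exponent. [cite: FlatleyTheil2015, §2 Definition 2.1 (item 1)] -/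
theorem not_isLocalizedPair_mieWith (α A B : ℝ) {p q : ℕ} (hq0 : 0 < q) (hq : q < 8)
    (hqp : q < p) : ¬ IsLocalizedPair α (mieWith A B p q) := by
  rcases eq_or_ne B 0 with rfl | hB
  · -- `B = 0`
    intro hV
    have h1 : A = -1 := by simpa using hV.apply_one
    subst h1
    have hp0 : (0 : ℝ) < p * (p + 1) := by
      have : (0 : ℝ) < p := by exact_mod_cast hq0.trans hqp
      positivity
    rcases le_or_gt α 0 with hα | hα
    · have h2 := (hV.decay 2 sqrt_seven_halves_le_two).trans
        (mul_nonpos_of_nonpos_of_nonneg hα (by positivity))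
      have h3 := abs_nonpos_iff.mp h2
      rw [iter_deriv_two_mieWith _ _ _ _ two_ne_zero] at h3
      have : (p * (p + 1) : ℝ) * (2 : ℝ)⁻¹ ^ (p + 2) = 0 := by simpa using h3
      exact absurd this (mul_pos hp0 (by positivity)).ne'
    · have h3 := hV.convex 1 ⟨by linarith, by linarith⟩
      rw [iter_deriv_two_mieWith _ _ _ _ one_ne_zero] at h3
      simp at h3
      linarith
  · -- `B ≠ 0`: the `r^{-q}` tail
    refine not_isLocalizedPair_of_tendsto_pow_mul_deriv2 (k := q + 2) (c := -((q * (q + 1) : ℝ) * B))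
      (by omega) ?_ ?_
    · have hq' : (0 : ℝ) < q * (q + 1) := by
        have : (0 : ℝ) < q := by exact_mod_cast hq0
        positivity
      exact neg_ne_zero.mpr (mul_ne_zero hq'.ne' hB)
    · -- `r^{q+2} V''(r) = p(p+1) A r⁻¹^(p-q) - q(q+1) B` for `r ≠ 0`
      obtain ⟨m, hm⟩ := Nat.exists_eq_add_of_lt hqp
      have key : ∀ r : ℝ, r ≠ 0 → r ^ (q + 2) * deriv^[2] (mieWith A B p q) r =
          (p * (p + 1) : ℝ) * A * r⁻¹ ^ (m + 1) - (q * (q + 1) : ℝ) * B := fun r hr => by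
        rw [iter_deriv_two_mieWith A B p q hr, mul_sub]
        have h1 : r ^ (q + 2) * r⁻¹ ^ (p + 2) = r⁻¹ ^ (m + 1) := by
          rw [hm, show q + m + 1 + 2 = (q + 2) + (m + 1) by ring, pow_add r⁻¹ (q + 2) (m + 1),
            ← mul_assoc, ← mul_pow, mul_inv_cancel₀ hr, one_pow, one_mul]
        have h2 : r ^ (q + 2) * r⁻¹ ^ (q + 2) = 1 := by
          rw [← mul_pow, mul_inv_cancel₀ hr, one_pow]
        calc r ^ (q + 2) * ((p * (p + 1) : ℝ) * A * r⁻¹ ^ (p + 2)) -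
              r ^ (q + 2) * ((q * (q + 1) : ℝ) * B * r⁻¹ ^ (q + 2))
            = (p * (p + 1) : ℝ) * A * (r ^ (q + 2) * r⁻¹ ^ (p + 2)) -
                (q * (q + 1) : ℝ) * B * (r ^ (q + 2) * r⁻¹ ^ (q + 2)) := by ring
          _ = _ := by rw [h1, h2, mul_one]
      have hlim : Tendsto (fun r : ℝ => (p * (p + 1) : ℝ) * A * r⁻¹ ^ (m + 1) - (q * (q + 1) : ℝ) * B)
          atTop (𝓝 ((p * (p + 1) : ℝ) * A * (0 : ℝ) ^ (m + 1) - (q * (q + 1) : ℝ) * B)) :=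
        (tendsto_const_nhds.mul ((tendsto_inv_atTop_zero (𝕜 := ℝ)).pow (m + 1))).sub
          tendsto_const_nhds
      rw [zero_pow (Nat.succ_ne_zero m), mul_zero, zero_sub] at hlim
      refine hlim.congr' ?_
      filter_upwards [eventually_ne_atTop (0 : ℝ)] with r hr
      exact (key r hr).symm

end FlatleyTheil2015

namespace Theil2006

/-- **Theil's decay condition (5) kills every tail `V'' ~ c r⁻ᵏ` with `k < 7`** (attractions
`-B r^{-q}` with `q < 5`); the van der Waals tail `q = 6` passes (5) asymptotically and is only
excluded quantitatively (`not_isAdmissible_lennardJonesWith`). [cite: Theil2006, §1 Theorem 1.1 (5)] -/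
theorem not_isAdmissible_of_tendsto_pow_mul_deriv2 {α : ℝ} {V : ℝ → ℝ} {k : ℕ} {c : ℝ}
    (hk : k < 7) (hc : c ≠ 0)
    (hlim : Tendsto (fun r : ℝ => r ^ k * deriv^[2] V r) atTop (𝓝 c)) :
    ¬ Literature.MathematicalPhysics.StatisticalMechanics.Theil2006.IsAdmissible α V := by
  intro hV
  have hbound : ∀ᶠ r : ℝ in atTop, |r ^ k * deriv^[2] V r| ≤ |α| * r⁻¹ ^ (7 - k) := by
    filter_upwards [eventually_gt_atTop (4 / 3 : ℝ)] with r hr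
    have hr0 : 0 < r := lt_trans (by norm_num) hr
    have hd := hV.decay r hr
    have hk' : r ^ k * r⁻¹ ^ 7 = r⁻¹ ^ (7 - k) := by
      have h7 : r⁻¹ ^ 7 = r⁻¹ ^ k * r⁻¹ ^ (7 - k) := by
        rw [← pow_add, Nat.add_sub_cancel' hk.le]
      rw [h7, ← mul_assoc, ← mul_pow, mul_inv_cancel₀ hr0.ne', one_pow, one_mul]
    calc |r ^ k * deriv^[2] V r| = r ^ k * |deriv^[2] V r| := by
          rw [abs_mul, abs_of_pos (pow_pos hr0 k)]
      _ ≤ r ^ k * (α * r⁻¹ ^ 7) := mul_le_mul_of_nonneg_left hd (pow_pos hr0 k).le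
      _ ≤ r ^ k * (|α| * r⁻¹ ^ 7) :=
          mul_le_mul_of_nonneg_left (mul_le_mul_of_nonneg_right (le_abs_self α) (by positivity))
            (pow_pos hr0 k).le
      _ = |α| * r⁻¹ ^ (7 - k) := by rw [← hk', mul_left_comm]
  have hzero : Tendsto (fun r : ℝ => |α| * r⁻¹ ^ (7 - k)) atTop (𝓝 0) := by
    have h := (tendsto_inv_atTop_zero (𝕜 := ℝ)).pow (7 - k)
    rw [zero_pow (by omega)] at h
    simpa using h.const_mul |α|
  have hlim0 : Tendsto (fun r : ℝ => r ^ k * deriv^[2] V r) atTop (𝓝 0) :=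
    squeeze_zero_norm' (by simpa only [Real.norm_eq_abs] using hbound) hzero
  exact hc (tendsto_nhds_unique hlim hlim0)

end Theil2006

/-! ## Bridge to the normalised Mie `(2p, p)` ladder `miePotential` (item `defn-miePotential`)

`Literature.MathematicalPhysics.StatisticalMechanics.miePotential p` (the light, Mathlib-only
module `MiePotential.lean`) is, by `rfl`, the member `A = 1/(2p)`, `B = 1/p`, exponents `(2p, p)`
of the `mieWith` family above. The identification is recorded HERE, downstream of that module,
so that the `(2q, q)`-ladder routes (`BrittleMieDescent`, `SteepnessLadderOneCentre`) keep an
import cone free of `Theil2006`; the two corollaries say which clauses of this barrier apply to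
which rungs: clause (ii) (Flatley–Theil's decay `|V''| ≤ α r⁻¹⁰`) to every rung `0 < p < 8`,
clause (i) (Theil's class) to the Lennard-Jones rung `p = 6` as proved above. Nothing is claimed
here about rungs `p ≥ 8`. -/

/-- `miePotential p = mieWith (1/(2p)) (1/p) (2p) p`, definitionally (both sides unfold to
`r ↦ (1/(2p)) r⁻¹^(2p) - (1/p) r⁻¹^p`). [folklore] -/
theorem miePotential_eq_mieWith (p : ℕ) :
    Literature.MathematicalPhysics.StatisticalMechanics.miePotential p =
      mieWith (1 / (2 * (p : ℝ))) (1 / (p : ℝ)) (2 * p) p := rfl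

namespace FlatleyTheil2015

/-- Clause (ii) along the ladder: for `0 < p < 8` — in particular at the Lennard-Jones rung
`p = 6` — the normalised Mie `(2p, p)` potential is not the pair part of an `α`-localized pair,
for any `α` (its `-r⁻ᵖ/p` tail has `r^{p+2} V''(r) → -(p+1) ≠ 0` with `p + 2 < 10`;
`not_isLocalizedPair_mieWith`). [cite: FlatleyTheil2015, §2 Definition 2.1 (item 1)] -/
theorem not_isLocalizedPair_miePotential (α : ℝ) {p : ℕ} (hp0 : 0 < p) (hp : p < 8) :
    ¬ IsLocalizedPair α (Literature.MathematicalPhysics.StatisticalMechanics.miePotential p) := by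
  rw [miePotential_eq_mieWith]
  exact not_isLocalizedPair_mieWith α _ _ hp0 hp (by omega)

end FlatleyTheil2015

namespace Theil2006

/-- Clause (i) at the Lennard-Jones rung of the ladder: `miePotential 6 = lennardJones` is not
Theil-admissible, for any `α` (`not_isAdmissible_lennardJones`). [cite: Theil2006, §1 Theorem 1.1] -/
theorem not_isAdmissible_miePotential_six (α : ℝ) :
    ¬ Literature.MathematicalPhysics.StatisticalMechanics.Theil2006.IsAdmissible α
      (Literature.MathematicalPhysics.StatisticalMechanics.miePotential 6) := by
  rw [Literature.MathematicalPhysics.StatisticalMechanics.miePotential_six]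
  exact not_isAdmissible_lennardJones α

end Theil2006

end Literature.Barriers.AtomisticToContinuum
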